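import Mathlib
import Literature.NumberTheory.LFunctions.SuzukiCanonicalSystem
import Literature.NumberTheory.LFunctions.SuzukiSingleOperatorKernelProofs
import Summits.RiemannHypothesis.RiemannHypothesis.Theorems.SuzukiHSWindow
import Summits.RiemannHypothesis.RiemannHypothesis.Theorems.SuzukiWindowsDoorHSWindow
import Summits.RiemannHypothesis.RiemannHypothesis.Theorems.SuzukiWindowsDoorGalerkinWindow
import HarnessLib

/-!
# The Galerkin certificate as a quadratic-form bound, and its monotonicity in the window (RH-free, K-general)

Companion of `SuzukiWindowsDoorGalerkinWindow` / `SuzukiWindowsDoorGalerkinBessel` (kernel-checked logic of the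
rh-dbr ET1b/ET1c op-norm window certificates).  The certificate data at window `t` — `K` continuous,
`φ₁,…,φₙ` bounded measurable orthonormal in `L²(S)`, `S = (−t,t)`, any matrix `M` with `|cᵀMc| ≤ μ₀|c|²`, and
`∫_S∫_S (K(x+y) − Σᵢⱼ Mᵢⱼφᵢ(x)φⱼ(y))² ≤ δ²` — bound the QUADRATIC FORM of the window operator:
`|∫_S f(x) ∫_S K(x+y) f(y) dy dx| ≤ (μ₀ + δ) ∫_S f²` for every `f ∈ L²(S)` (`abs_quadForm_le_of_galerkin_certificate`;
i.e. `‖𝖪[t]‖ ≤ μ₀ + δ` for the self-adjoint compression).  Consequently a certificate with `μ₀ + δ < 1` at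
window `t` excludes the eigenvalues `±1` on EVERY smaller window `t′ ≤ t` (extend an eigenfunction on `(−t′,t′)`
by zero): `noUnitEigenvalue_of_galerkin_certificate_of_le` — the «and all t′ ≤ t» clause of the cell's data
rungs (DATA.md §ET1b/§ET1c), now kernel-checked.  RH-FREE; nothing here bears on the truth of RH.

References: M. Suzuki, J. Funct. Anal. 281 (2021) 109116 = arXiv:1606.05726, §3.4; M. Suzuki, ASPM 84 (2020) =
arXiv:1907.07302, Thm. 1.2.
-/

set_option linter.dupNamespace false

noncomputable section

open MeasureTheory Set

namespace Summit.RiemannHypothesis.RiemannHypothesis.Theorems.SuzukiWindowsDoorGalerkinMonotone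

open Summit.RiemannHypothesis.RiemannHypothesis.Theorems.SuzukiWindowsDoorHSWindow (two_mul_le_weighted_sq)
open Summit.RiemannHypothesis.RiemannHypothesis.Theorems.SuzukiWindowsDoorGalerkinWindow (sum_sq_integral_mul_le)

/-- **Quadratic-form bound from a Galerkin certificate** (RH-free, K-general): with the certificate data
`(φ, M, μ₀, δ)` at window `S = (−t,t)` (orthonormal bounded measurable `φ`, `|cᵀMc| ≤ μ₀|c|²`, finite-rank remainder
of `L²(S²)`-norm `≤ δ`), every `f ∈ L²(S)` satisfies `|∫_S f(x) (∫_S K(x+y) f(y) dy) dx| ≤ (μ₀ + δ) ∫_S f²`.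
[cite: Suzuki2021Hamiltonians, §3.4; folklore: Bessel, Cauchy–Schwarz] -/
theorem abs_quadForm_le_of_galerkin_certificate {K : ℝ → ℝ} (hK : Continuous K) {t : ℝ} {n : ℕ}
    {φ : Fin n → ℝ → ℝ} (hφm : ∀ i, Measurable (φ i)) {B : ℝ} (hφb : ∀ i x, |φ i x| ≤ B)
    (horth : ∀ i j, ∫ x in Ioo (-t) t, φ i x * φ j x = if i = j then 1 else 0)
    (M : Matrix (Fin n) (Fin n) ℝ) {μ₀ δ : ℝ} (hμ₀ : 0 ≤ μ₀) (hδ : 0 < δ)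
    (hM : ∀ c : Fin n → ℝ, |∑ i, ∑ j, c i * M i j * c j| ≤ μ₀ * ∑ i, c i ^ 2)
    (hD : ∫ x in Ioo (-t) t, ∫ y in Ioo (-t) t,
      (K (x + y) - ∑ i, ∑ j, M i j * φ i x * φ j y) ^ 2 ≤ δ ^ 2)
    {f : ℝ → ℝ} (hf : MemLp f 2 (volume.restrict (Ioo (-t) t))) :
    |∫ x in Ioo (-t) t, f x * ∫ y in Ioo (-t) t, K (x + y) * f y| ≤
      (μ₀ + δ) * ∫ x in Ioo (-t) t, f x ^ 2 := by
  set μ : Measure ℝ := volume.restrict (Ioo (-t) t) with hμ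
  haveI : IsFiniteMeasure μ := by
    rw [hμ]; exact isFiniteMeasure_restrict.2 (by rw [Real.volume_Ioo]; exact ENNReal.ofReal_ne_top)
  -- the remainder kernel
  set D : ℝ → ℝ → ℝ := fun x y => K (x + y) - ∑ i, ∑ j, M i j * φ i x * φ j y with hDdef
  -- basic integrability facts
  have hf2 : Integrable (fun x => f x ^ 2) μ := hf.integrable_sq
  have hf1 : Integrable f μ := hf.integrable one_le_two
  set A : ℝ := ∫ x, f x ^ 2 ∂μ with hA
  have hA0 : 0 ≤ A := integral_nonneg fun x => sq_nonneg _
  have hφae : ∀ i, AEStronglyMeasurable (φ i) μ := fun i => (hφm i).aestronglyMeasurable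
  have hφbd : ∀ i, ∀ᵐ x ∂μ, ‖φ i x‖ ≤ B := fun i =>
    Filter.Eventually.of_forall fun x => by rw [Real.norm_eq_abs]; exact hφb i x
  have hφ1 : ∀ i, Integrable (φ i) μ := fun i =>
    (MemLp.of_bound (hφae i) B (hφbd i) : MemLp (φ i) 1 μ).integrable le_rfl
  have hφf : ∀ i, Integrable (fun y => φ i y * f y) μ := fun i => hf1.bdd_mul (hφae i) (hφbd i)
  set c : Fin n → ℝ := fun i => ∫ y, φ i y * f y ∂μ with hc
  -- Bessel: Σ cᵢ² ≤ A
  have hBessel : ∑ i, c i ^ 2 ≤ A := sum_sq_integral_mul_le hφm hφb horth hf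
  -- kernel rows are in L²
  have hKL2 : ∀ x, MemLp (fun y => K (x + y)) 2 μ := fun x => SuzukiHSWindow.memLp_two_kernel_row hK t x
  have hKf : ∀ x, Integrable (fun y => K (x + y) * f y) μ := fun x => (hKL2 x).integrable_mul hf
  -- the finite-rank rows are bounded measurable
  have hφB : ∀ i x, |φ i x| ≤ |B| := fun i x => (hφb i x).trans (le_abs_self B)
  set CR : ℝ := ∑ i, ∑ j, |M i j| * |B| * |B| with hCR
  have hRm : ∀ x, AEStronglyMeasurable (fun y => ∑ i, ∑ j, M i j * φ i x * φ j y) μ := by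
    intro x
    refine Finset.aestronglyMeasurable_fun_sum _ fun i _ => Finset.aestronglyMeasurable_fun_sum _ fun j _ => ?_
    exact (hφae j).const_mul (M i j * φ i x)
  have hRabs : ∀ x y, |∑ i, ∑ j, M i j * φ i x * φ j y| ≤ CR := by
    intro x y
    calc |∑ i, ∑ j, M i j * φ i x * φ j y| ≤ ∑ i, |∑ j, M i j * φ i x * φ j y| :=
          Finset.abs_sum_le_sum_abs _ _
      _ ≤ ∑ i, ∑ j, |M i j * φ i x * φ j y| :=
          Finset.sum_le_sum fun i _ => Finset.abs_sum_le_sum_abs _ _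
      _ ≤ ∑ i, ∑ j, |M i j| * |B| * |B| := by
          refine Finset.sum_le_sum fun i _ => Finset.sum_le_sum fun j _ => ?_
          rw [abs_mul, abs_mul]
          exact mul_le_mul (mul_le_mul_of_nonneg_left (hφB i x) (abs_nonneg _)) (hφB j y)
            (abs_nonneg _) (mul_nonneg (abs_nonneg _) (abs_nonneg _))
  have hRb : ∀ x, ∀ᵐ y ∂μ, ‖∑ i, ∑ j, M i j * φ i x * φ j y‖ ≤ CR := fun x =>
    Filter.Eventually.of_forall fun y => by rw [Real.norm_eq_abs]; exact hRabs x y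
  have hRf : ∀ x, Integrable (fun y => (∑ i, ∑ j, M i j * φ i x * φ j y) * f y) μ := fun x =>
    hf1.bdd_mul (hRm x) (hRb x)
  have hDf : ∀ x, Integrable (fun y => D x y * f y) μ := by
    intro x
    refine ((hKf x).sub (hRf x)).congr (Filter.Eventually.of_forall fun y => ?_)
    simp only [hDdef, Pi.sub_apply]
    ring
  have hD2 : ∀ x, Integrable (fun y => D x y ^ 2) μ := by
    intro x
    have h : MemLp (fun y => D x y) 2 μ := (hKL2 x).sub (MemLp.of_bound (hRm x) CR (hRb x) : MemLp _ 2 μ)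
    exact h.integrable_sq
  -- a uniform bound for D on the square, hence x ↦ ∫ D(x,y)² dy is integrable on the window
  obtain ⟨CK, hCK⟩ := (isCompact_Icc : IsCompact (Icc (-(2 * |t|)) (2 * |t|))).exists_bound_of_continuousOn
    hK.continuousOn
  have hDbd : ∀ x ∈ Ioo (-t) t, ∀ y ∈ Ioo (-t) t, ‖D x y ^ 2‖ ≤ (CK + CR) ^ 2 := by
    intro x hx y hy
    have hKb : ‖K (x + y)‖ ≤ CK := hCK (x + y) ⟨by nlinarith [hx.1, hy.1, le_abs_self t, neg_abs_le t],
      by nlinarith [hx.2, hy.2, le_abs_self t]⟩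
    rw [Real.norm_eq_abs] at hKb
    have hDb : |D x y| ≤ CK + CR := by
      calc |D x y| = |K (x + y) - ∑ i, ∑ j, M i j * φ i x * φ j y| := rfl
        _ ≤ |K (x + y)| + |∑ i, ∑ j, M i j * φ i x * φ j y| := abs_sub _ _
        _ ≤ CK + CR := add_le_add hKb (hRabs x y)
    rw [Real.norm_eq_abs, abs_pow, ← sq_abs (CK + CR)]
    exact pow_le_pow_left₀ (abs_nonneg _) (hDb.trans (le_abs_self _)) 2
  have hDx : Integrable (fun x => ∫ y, D x y ^ 2 ∂μ) μ := by
    have hDm2 : Measurable fun p : ℝ × ℝ => D p.1 p.2 ^ 2 := by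
      have hR2 : Measurable fun p : ℝ × ℝ => ∑ i, ∑ j, M i j * φ i p.1 * φ j p.2 :=
        Finset.measurable_fun_sum _ fun i _ => Finset.measurable_fun_sum _ fun j _ =>
          (measurable_const.mul ((hφm i).comp measurable_fst)).mul ((hφm j).comp measurable_snd)
      exact ((hK.measurable.comp (measurable_fst.add measurable_snd)).sub hR2).pow_const 2
    have hsm : StronglyMeasurable (Function.uncurry fun x y : ℝ => D x y ^ 2) := hDm2.stronglyMeasurable
    have hmeas : StronglyMeasurable fun x : ℝ => ∫ y in Ioo (-t) t, D x y ^ 2 := hsm.integral_prod_right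
    refine Integrable.mono' (integrable_const ((CK + CR) ^ 2 * volume.real (Ioo (-t) t)))
      hmeas.aestronglyMeasurable ?_
    filter_upwards [ae_restrict_mem measurableSet_Ioo] with x hx
    exact norm_setIntegral_le_of_norm_le_const (μ := volume) (s := Ioo (-t) t)
      (by rw [Real.volume_Ioo]; exact ENNReal.ofReal_lt_top) (fun y hy => hDbd x hx y hy)
  have hDD : ∫ x, ∫ y, D x y ^ 2 ∂μ ∂μ ≤ δ ^ 2 := hD
  have hDD0 : 0 ≤ ∫ x, ∫ y, D x y ^ 2 ∂μ ∂μ := integral_nonneg fun x => integral_nonneg fun y => sq_nonneg _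
  have hcoef : 0 ≤ (μ₀ + δ) * A := mul_nonneg (by linarith) hA0
  -- if the integrand is not integrable, the integral is zero by convention
  by_cases hint : Integrable (fun x => f x * ∫ y, K (x + y) * f y ∂μ) μ
  swap
  · rw [integral_undef hint, abs_zero]; exact hcoef
  -- splitting the row integral into the remainder part and the finite-rank part
  have hsplit : ∀ x, ∫ y, K (x + y) * f y ∂μ = (∫ y, D x y * f y ∂μ) + ∑ i, ∑ j, M i j * φ i x * c j := by
    intro x
    have h1 : (fun y => K (x + y) * f y) =
        fun y => D x y * f y + (∑ i, ∑ j, M i j * φ i x * φ j y) * f y := by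
      funext y; simp only [hDdef]; ring
    rw [h1, integral_add (hDf x) (hRf x)]
    congr 1
    have h2 : (fun y => (∑ i, ∑ j, M i j * φ i x * φ j y) * f y) =
        fun y => ∑ i, ∑ j, M i j * φ i x * (φ j y * f y) := by
      funext y; simp only [Finset.sum_mul]
      exact Finset.sum_congr rfl fun i _ => Finset.sum_congr rfl fun j _ => by ring
    rw [h2, integral_finsetSum _ fun i _ => ?_]
    · refine Finset.sum_congr rfl fun i _ => ?_
      rw [integral_finsetSum _ fun j _ => (hφf j).const_mul _]
      exact Finset.sum_congr rfl fun j _ => by rw [integral_const_mul]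
    · exact integrable_finsetSum _ fun j _ => (hφf j).const_mul _
  -- the finite-rank term
  have hLf : Integrable (fun x => f x * ∑ i, ∑ j, M i j * φ i x * c j) μ := by
    have : Integrable (fun x => ∑ i, ∑ j, (M i j * c j) * (φ i x * f x)) μ :=
      integrable_finsetSum _ fun i _ => integrable_finsetSum _ fun j _ => (hφf i).const_mul _
    refine this.congr (Filter.Eventually.of_forall fun x => ?_)
    simp only [Finset.mul_sum]
    exact Finset.sum_congr rfl fun i _ => Finset.sum_congr rfl fun j _ => by ring
  have hLint : ∫ x, f x * ∑ i, ∑ j, M i j * φ i x * c j ∂μ = ∑ i, ∑ j, c i * M i j * c j := by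
    have h1 : (fun x => f x * ∑ i, ∑ j, M i j * φ i x * c j) =
        fun x => ∑ i, ∑ j, (M i j * c j) * (φ i x * f x) := by
      funext x; simp only [Finset.mul_sum]
      exact Finset.sum_congr rfl fun i _ => Finset.sum_congr rfl fun j _ => by ring
    rw [h1, integral_finsetSum _ fun i _ => ?_]
    · refine Finset.sum_congr rfl fun i _ => ?_
      rw [integral_finsetSum _ fun j _ => (hφf i).const_mul _]
      refine Finset.sum_congr rfl fun j _ => ?_
      rw [integral_const_mul]
      show M i j * c j * c i = c i * M i j * c j
      ring
    · exact integrable_finsetSum _ fun j _ => (hφf i).const_mul _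
  have hDfx : Integrable (fun x => f x * ∫ y, D x y * f y ∂μ) μ := by
    refine (hint.sub hLf).congr (Filter.Eventually.of_forall fun x => ?_)
    simp only [Pi.sub_apply]
    rw [hsplit x]; ring
  have hQ : ∫ x, f x * ∫ y, K (x + y) * f y ∂μ ∂μ =
      (∫ x, f x * ∫ y, D x y * f y ∂μ ∂μ) + ∑ i, ∑ j, c i * M i j * c j := by
    rw [← hLint, ← integral_add hDfx hLf]
    refine integral_congr_ae (Filter.Eventually.of_forall fun x => ?_)
    simp only
    rw [hsplit x]; ring
  -- the key inequality for the remainder part: for every λ > 0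
  have key : ∀ lam : ℝ, 0 < lam →
      |∫ x, f x * ∫ y, D x y * f y ∂μ ∂μ| ≤ lam / 2 * δ ^ 2 + A * A / (2 * lam) := by
    intro lam hlam
    have hpt : ∀ x, |f x * ∫ y, D x y * f y ∂μ| ≤ lam / 2 * ∫ y, D x y ^ 2 ∂μ + f x ^ 2 * A / (2 * lam) := by
      intro x
      have h1 : Integrable (fun y => D x y ^ 2) μ := hD2 x
      have hrhs_int : Integrable (fun y => (lam * D x y ^ 2 + (f x * f y) ^ 2 / lam) / 2) μ := by
        have : Integrable (fun y => lam * D x y ^ 2 + (f x) ^ 2 / lam * f y ^ 2) μ :=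
          (h1.const_mul lam).add (hf2.const_mul _)
        refine (this.div_const 2).congr (Filter.Eventually.of_forall fun y => ?_)
        simp only
        ring
      have heq : ∫ y, (lam * D x y ^ 2 + (f x * f y) ^ 2 / lam) / 2 ∂μ =
          lam / 2 * ∫ y, D x y ^ 2 ∂μ + f x ^ 2 * A / (2 * lam) := by
        calc ∫ y, (lam * D x y ^ 2 + (f x * f y) ^ 2 / lam) / 2 ∂μ
            = ∫ y, (lam / 2 * D x y ^ 2 + f x ^ 2 / (2 * lam) * f y ^ 2) ∂μ := by
              refine integral_congr_ae (Filter.Eventually.of_forall fun y => ?_); simp only; ring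
          _ = lam / 2 * ∫ y, D x y ^ 2 ∂μ + f x ^ 2 / (2 * lam) * ∫ y, f y ^ 2 ∂μ := by
              rw [integral_add (h1.const_mul _) (hf2.const_mul _), integral_const_mul, integral_const_mul]
          _ = lam / 2 * ∫ y, D x y ^ 2 ∂μ + f x ^ 2 * A / (2 * lam) := by rw [← hA]; ring
      rw [← integral_const_mul]
      calc |∫ y, f x * (D x y * f y) ∂μ| ≤ ∫ y, |f x * (D x y * f y)| ∂μ := abs_integral_le_integral_abs
        _ ≤ ∫ y, (lam * D x y ^ 2 + (f x * f y) ^ 2 / lam) / 2 ∂μ := by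
            refine integral_mono_ae ((hDf x).const_mul _).abs hrhs_int
              (Filter.Eventually.of_forall fun y => ?_)
            have hb := two_mul_le_weighted_sq (D x y) (f x * f y) lam hlam
            have hb' := two_mul_le_weighted_sq (-(D x y)) (f x * f y) lam hlam
            have hre : |f x * (D x y * f y)| = |D x y * (f x * f y)| := by
              rw [show f x * (D x y * f y) = D x y * (f x * f y) by ring]
            show |f x * (D x y * f y)| ≤ (lam * D x y ^ 2 + (f x * f y) ^ 2 / lam) / 2
            rw [hre, abs_le]
            constructor
            · nlinarith [hb', sq_nonneg (D x y)]
            · nlinarith [hb]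
        _ = _ := heq
    have hrhs : Integrable (fun x => lam / 2 * ∫ y, D x y ^ 2 ∂μ + f x ^ 2 * A / (2 * lam)) μ := by
      have : Integrable (fun x => lam / 2 * ∫ y, D x y ^ 2 ∂μ + A / (2 * lam) * f x ^ 2) μ :=
        (hDx.const_mul _).add (hf2.const_mul _)
      refine this.congr (Filter.Eventually.of_forall fun x => ?_); simp only; ring
    have hlam2 : 0 ≤ lam / 2 := by positivity
    calc |∫ x, f x * ∫ y, D x y * f y ∂μ ∂μ| ≤ ∫ x, |f x * ∫ y, D x y * f y ∂μ| ∂μ :=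
          abs_integral_le_integral_abs
      _ ≤ ∫ x, (lam / 2 * ∫ y, D x y ^ 2 ∂μ + f x ^ 2 * A / (2 * lam)) ∂μ :=
          integral_mono_ae hDfx.abs hrhs (Filter.Eventually.of_forall hpt)
      _ = lam / 2 * (∫ x, ∫ y, D x y ^ 2 ∂μ ∂μ) + A * A / (2 * lam) := by
          calc ∫ x, (lam / 2 * ∫ y, D x y ^ 2 ∂μ + f x ^ 2 * A / (2 * lam)) ∂μ
              = ∫ x, (lam / 2 * ∫ y, D x y ^ 2 ∂μ + A / (2 * lam) * f x ^ 2) ∂μ := by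
                refine integral_congr_ae (Filter.Eventually.of_forall fun x => ?_); simp only; ring
            _ = lam / 2 * (∫ x, ∫ y, D x y ^ 2 ∂μ ∂μ) + A / (2 * lam) * A := by
                rw [integral_add (hDx.const_mul _) (hf2.const_mul _), integral_const_mul, integral_const_mul, ← hA]
            _ = lam / 2 * (∫ x, ∫ y, D x y ^ 2 ∂μ ∂μ) + A * A / (2 * lam) := by ring
      _ ≤ lam / 2 * δ ^ 2 + A * A / (2 * lam) := by nlinarith [mul_le_mul_of_nonneg_left hDD hlam2]
  have hfin : |∑ i, ∑ j, c i * M i j * c j| ≤ μ₀ * A := (hM c).trans (mul_le_mul_of_nonneg_left hBessel hμ₀)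
  -- conclude
  rw [hQ]
  by_cases hAz : A = 0
  · -- then f = 0 a.e. and the remainder part vanishes
    have hsq : (fun x => f x ^ 2) =ᵐ[μ] 0 := by
      have := (integral_eq_zero_iff_of_nonneg_ae (Filter.Eventually.of_forall fun x => sq_nonneg (f x)) hf2).1
      rw [← hA] at this
      exact this hAz
    have hf0 : f =ᵐ[μ] 0 := by filter_upwards [hsq] with x hx; simpa using hx
    have hD0 : ∫ x, f x * ∫ y, D x y * f y ∂μ ∂μ = 0 := by
      have : (fun x => f x * ∫ y, D x y * f y ∂μ) =ᵐ[μ] 0 := by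
        filter_upwards [hf0] with x hx; simp [hx]
      rw [integral_congr_ae this]; simp
    rw [hD0, zero_add]
    calc |∑ i, ∑ j, c i * M i j * c j| ≤ μ₀ * A := hfin
      _ ≤ (μ₀ + δ) * A := by nlinarith [hA0, hδ]
  · have hApos : 0 < A := lt_of_le_of_ne hA0 (Ne.symm hAz)
    have hk := key (A / δ) (div_pos hApos hδ)
    have h1 : A / δ / 2 * δ ^ 2 = A * δ / 2 := by field_simp
    have h2 : A * A / (2 * (A / δ)) = A * δ / 2 := by field_simp
    rw [h1, h2] at hk
    calc |(∫ x, f x * ∫ y, D x y * f y ∂μ ∂μ) + ∑ i, ∑ j, c i * M i j * c j|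
        ≤ |∫ x, f x * ∫ y, D x y * f y ∂μ ∂μ| + |∑ i, ∑ j, c i * M i j * c j| := abs_add_le _ _
      _ ≤ (A * δ / 2 + A * δ / 2) + μ₀ * A := add_le_add hk hfin
      _ = (μ₀ + δ) * A := by ring

/-- **Monotone Galerkin window certificate** (RH-free, K-general): a certificate at window `t`
(`K` continuous; `φ` bounded measurable orthonormal on `(−t,t)`; `M` with `|cᵀMc| ≤ μ₀|c|²`; finite-rank remainder
`≤ δ` in `L²((−t,t)²)`; `μ₀ + δ < 1`) gives `NoUnitEigenvalue K t′` for EVERY `t′ ≤ t` — an eigenfunction on the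
smaller window, extended by zero, would violate the quadratic-form bound `|⟨f, 𝖪[t]f⟩| ≤ (μ₀+δ)‖f‖²`.  This is the
«and every t′ ≤ t» clause attached to the cell rh-dbr's certified windows. [cite: Suzuki2021Hamiltonians, §3.4] -/
theorem noUnitEigenvalue_of_galerkin_certificate_of_le {K : ℝ → ℝ} (hK : Continuous K) {t : ℝ} {n : ℕ}
    {φ : Fin n → ℝ → ℝ} (hφm : ∀ i, Measurable (φ i)) {B : ℝ} (hφb : ∀ i x, |φ i x| ≤ B)
    (horth : ∀ i j, ∫ x in Ioo (-t) t, φ i x * φ j x = if i = j then 1 else 0)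
    (M : Matrix (Fin n) (Fin n) ℝ) {μ₀ δ : ℝ} (hμ₀ : 0 ≤ μ₀) (hδ : 0 < δ)
    (hM : ∀ c : Fin n → ℝ, |∑ i, ∑ j, c i * M i j * c j| ≤ μ₀ * ∑ i, c i ^ 2)
    (hD : ∫ x in Ioo (-t) t, ∫ y in Ioo (-t) t,
      (K (x + y) - ∑ i, ∑ j, M i j * φ i x * φ j y) ^ 2 ≤ δ ^ 2)
    (hΛ : μ₀ + δ < 1) {t' : ℝ} (ht' : t' ≤ t) :
    Literature.NumberTheory.LFunctions.NoUnitEigenvalue K t' := by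
  intro ε hε f hf heig
  have hε2 : ε ^ 2 = 1 := by rcases hε with rfl | rfl <;> norm_num
  have hεabs : |ε| = 1 := by rcases hε with rfl | rfl <;> norm_num
  have hSS : Ioo (-t') t' ⊆ Ioo (-t) t := Ioo_subset_Ioo (neg_le_neg ht') ht'
  have hres : (volume.restrict (Ioo (-t) t)).restrict (Ioo (-t') t') = volume.restrict (Ioo (-t') t') := by
    rw [Measure.restrict_restrict measurableSet_Ioo, Set.inter_eq_left.2 hSS]
  -- the zero-extension g of f is in L²(−t,t)
  have hgL2 : MemLp ((Ioo (-t') t').indicator f) 2 (volume.restrict (Ioo (-t) t)) := by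
    rw [memLp_indicator_iff_restrict measurableSet_Ioo, hres]
    exact hf
  have hQ := abs_quadForm_le_of_galerkin_certificate hK hφm hφb horth M hμ₀ hδ hM hD hgL2
  -- ∫ g² = ∫_{S'} f²
  have hA : ∫ x in Ioo (-t) t, (Ioo (-t') t').indicator f x ^ 2 = ∫ x in Ioo (-t') t', f x ^ 2 := by
    have h1 : (fun x => (Ioo (-t') t').indicator f x ^ 2) = (Ioo (-t') t').indicator (fun x => f x ^ 2) := by
      funext x
      by_cases hx : x ∈ Ioo (-t') t'
      · simp [Set.indicator_of_mem hx]
      · simp [Set.indicator_of_notMem hx]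
    rw [h1, integral_indicator measurableSet_Ioo, hres]
  -- the quadratic form of g equals ε ∫_{S'} f²
  have hinner : ∀ x, ∫ y in Ioo (-t) t, K (x + y) * (Ioo (-t') t').indicator f y =
      ∫ y in Ioo (-t') t', K (x + y) * f y := by
    intro x
    have h1 : (fun y => K (x + y) * (Ioo (-t') t').indicator f y) =
        (Ioo (-t') t').indicator (fun y => K (x + y) * f y) := by
      funext y; rw [Set.indicator_mul_right]
    rw [h1, integral_indicator measurableSet_Ioo, hres]
  have hQeq : ∫ x in Ioo (-t) t, (Ioo (-t') t').indicator f x *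
        ∫ y in Ioo (-t) t, K (x + y) * (Ioo (-t') t').indicator f y =
      ε * ∫ x in Ioo (-t') t', f x ^ 2 := by
    have h1 : (fun x => (Ioo (-t') t').indicator f x *
        ∫ y in Ioo (-t) t, K (x + y) * (Ioo (-t') t').indicator f y) =
        (Ioo (-t') t').indicator (fun x => f x * ∫ y in Ioo (-t') t', K (x + y) * f y) := by
      funext x; rw [hinner x, Set.indicator_mul_left]
    rw [h1, integral_indicator measurableSet_Ioo, hres]
    have h2 : (fun x => f x * ∫ y in Ioo (-t') t', K (x + y) * f y) =ᵐ[volume.restrict (Ioo (-t') t')]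
        fun x => ε * f x ^ 2 := by
      filter_upwards [heig] with x hx
      rw [hx]; ring
    rw [integral_congr_ae h2, integral_const_mul]
  -- conclude A' = 0
  set A' : ℝ := ∫ x in Ioo (-t') t', f x ^ 2 with hA'
  have hA'0 : 0 ≤ A' := integral_nonneg fun x => sq_nonneg _
  rw [hQeq, hA, abs_mul, hεabs, one_mul, abs_of_nonneg hA'0] at hQ
  have hA'z : A' = 0 := by nlinarith [hQ, hΛ, hA'0]
  have hf2 : Integrable (fun x => f x ^ 2) (volume.restrict (Ioo (-t') t')) := hf.integrable_sq
  have hsq : (fun x => f x ^ 2) =ᵐ[volume.restrict (Ioo (-t') t')] 0 := by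
    have := (integral_eq_zero_iff_of_nonneg_ae (Filter.Eventually.of_forall fun x => sq_nonneg (f x)) hf2).1
    exact this hA'z
  filter_upwards [hsq] with x hx
  simpa using hx

/-- **Instance for Suzuki's single operator** (RH-free): a Galerkin certificate for `K_θ = limKernel θ`
(`θ > 1`) at window `t` excludes the eigenvalues `±1` of `𝖪_θ[t′]` for every `t′ ≤ t`.  E.g. the cell rh-dbr's
two-lineage certificates at (θ, t) = (12, 1.4) and (20, 1.5) (DATA.md §ET1c) cover all smaller windows; such
instances are unconditional finite facts, never evidence for RH. [cite: Suzuki2020IntegralOperators, Thm. 1.2 (K-v)] -/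
theorem noUnitEigenvalue_limKernel_of_galerkin_certificate_of_le {θ t : ℝ} (hθ : 1 < θ) {n : ℕ}
    {φ : Fin n → ℝ → ℝ} (hφm : ∀ i, Measurable (φ i)) {B : ℝ} (hφb : ∀ i x, |φ i x| ≤ B)
    (horth : ∀ i j, ∫ x in Ioo (-t) t, φ i x * φ j x = if i = j then 1 else 0)
    (M : Matrix (Fin n) (Fin n) ℝ) {μ₀ δ : ℝ} (hμ₀ : 0 ≤ μ₀) (hδ : 0 < δ)
    (hM : ∀ c : Fin n → ℝ, |∑ i, ∑ j, c i * M i j * c j| ≤ μ₀ * ∑ i, c i ^ 2)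
    (hD : ∫ x in Ioo (-t) t, ∫ y in Ioo (-t) t,
      (Literature.NumberTheory.LFunctions.limKernel θ (x + y) - ∑ i, ∑ j, M i j * φ i x * φ j y) ^ 2 ≤ δ ^ 2)
    (hΛ : μ₀ + δ < 1) {t' : ℝ} (ht' : t' ≤ t) :
    Literature.NumberTheory.LFunctions.NoUnitEigenvalue (Literature.NumberTheory.LFunctions.limKernel θ) t' :=
  noUnitEigenvalue_of_galerkin_certificate_of_le
    (Literature.NumberTheory.LFunctions.Suzuki2020_thm12_continuous hθ) hφm hφb horth M hμ₀ hδ hM hD hΛ ht'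

end Summit.RiemannHypothesis.RiemannHypothesis.Theorems.SuzukiWindowsDoorGalerkinMonotone

end
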